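import Summits.Ventures.LatticeQCDFlow.Scoring.ChainWindowFunctionalCLT
import Summits.Ventures.LatticeQCDFlow.Scoring.LagProductCovariance
import Summits.Ventures.LatticeQCDFlow.Scoring.CramerWoldDevice

/-!
# The JOINT CLT for the empirical autocovariances of a bounded observable along a chain with a
# Doeblin power, from EVERY initial law: `√N ((Γ̂_N(t))_{t≤W} − (C(t))_{t≤W}) ⇒ Z` in `ℝ^{W+1}`

HONEST FRAMING: exact (Metropolis-corrected) sampling algorithms for lattice gauge theory;
figures of merit are autocorrelation/cost numbers at stated couplings and volumes; no
continuum-physics claim.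

Venture `LatticeQCDFlow` (cell pub-lqcd), sub-topic `Scoring`; FANOUT row 16 (`su2-base`), GEN-9.
NEW WORK of the cell, not a published result; one definition (`lagProdComb`, the linear combination of
lag products read on a window); nothing is cited as a fact (the joint asymptotic normality of sample
autocovariances of a mixing stationary sequence — Bartlett 1946; Anderson 1971 Thm 8.4.2; Ibragimov–Linnik
1971 — NAMED ONLY).  MARKOV-CHAIN COUNTERPART of GEN-7's `Scoring/LagProductCLT.tendstoInDistribution_acovHat`
(there: `X_i` a finite-range functional of an i.i.d. sequence; here: `X_i = f̄(X_i)` ALONG A CHAIN WITH A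
DOEBLIN POWER, from ANY initial law).  The statistic is the same `Scoring.acovHat` (known mean, `N` lag
products, normalised by `N`) applied to the centred observable `f̄ = f − π f` read along the path;
the centring is the stationary autocovariance `C(t) = Scoring.autocov κ π f̄ t = E_π[f̄(X_0) f̄(X_t)]`
(row 8's `chain_autocov`).  Proof: Cramér–Wold (`Scoring/CramerWoldDevice`); each projection
`⟪a, √N(Γ̂_N − C)⟫` is `(√N)⁻¹ Σ_{i<N} (φ_a(Y_i) − E_π φ_a(Y_0))` for the WINDOW FUNCTIONAL
`φ_a(y) = Σ_t a_t f̄(y_0) f̄(y_t)` of `Y_i = (X_i, …, X_{i+W})`, to which GEN-9's any-start CLT for window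
functionals (`Scoring/ChainWindowFunctionalCLT`) applies.

## Content (`κ` Markov on `S`, `π` invariant, `(nHit κ m)(z,·) ≥ ε ν` for all `z`, `ε ≠ 0`, `0 < m`;
## `|f| ≤ C` measurable, `f̄ = f − ∫ f dπ`; `μ₀` ANY initial law; `W` a window)

* `lagProdComb g W a` [ours] — `y ↦ Σ_{t ≤ W} a_t g(y_0) g(y_t)`; measurable, bounded by `(Σ|a_t|) C²`;
  `lagProdComb_windowPath`; `integral_lagProdComb_window_zero` (`E_π = Σ_t a_t autocov κ π g t`);
  `inner_sqrt_smul_sub_eq` (the projection algebra).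
* **`tendstoInDistribution_chain_acovHat_of_nHit`** — THE THEOREM: for every random vector `Z` of
  `ℝ^{W+1}` with `⟪a, Z⟫ ∼ N(0, windowLRVar κ π W (lagProdComb f̄ W a))` for all `a` (the long-run
  variance of the projected lag-product series under `P_π`), and EVERY initial law `μ₀`:
  `√N • ((acovHat (f̄ ∘ X) N t)_{t≤W} − (autocov κ π f̄ t)_{t≤W}) ⇒ Z` under `P_{μ₀}`.

NOT CLAIMED: the matrix form `aᵀ Σ a` of the variance functional and the existence of `Z` (bilinearity
needs the summability bookkeeping; next files); the scorers' centred `1/(N−t)` statistic (mean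
subtraction along a chain); rates; unbounded `f`.
-/

noncomputable section

open MeasureTheory ProbabilityTheory Filter Finset Preorder WithLp
open scoped ENNReal Topology RealInnerProductSpace
open Summit.Ventures.LatticeQCDFlow.Exactness Summit.Ventures.LatticeQCDFlow.Exactness.GeneralNCMC

namespace Summit.Ventures.LatticeQCDFlow.Scoring

variable {S : Type*}

/-! ## The lag-product combination read on a window -/

section LagProdComb

/-- The linear combination of lag products read on one window:
`lagProdComb g W a y = Σ_{t ≤ W} a_t · g(y_0) g(y_t)`. [ours] -/
def lagProdComb (g : S → ℝ) (W : ℕ) (a : EuclideanSpace ℝ (Fin (W + 1))) (y : Fin (W + 1) → S) : ℝ :=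
  ∑ t : Fin (W + 1), a t * (g (y 0) * g (y t))

/-- On the `i`-th window of a path: `Σ_t a_t g(x_i) g(x_{i+t})`. -/
theorem lagProdComb_windowPath (g : S → ℝ) (W : ℕ) (a : EuclideanSpace ℝ (Fin (W + 1))) (x : ℕ → S)
    (i : ℕ) : lagProdComb g W a (windowPath W x i) = ∑ t : Fin (W + 1), a t * (g (x i) * g (x (i + t))) := by
  simp only [lagProdComb, windowPath_apply, Fin.val_zero, Nat.add_zero]

/-- Boundedness: `|g| ≤ C ⇒ |lagProdComb g W a y| ≤ (Σ_t |a_t|) · C²`. -/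
theorem abs_lagProdComb_le {g : S → ℝ} {C : ℝ} (hC : ∀ z, |g z| ≤ C) (W : ℕ)
    (a : EuclideanSpace ℝ (Fin (W + 1))) (y : Fin (W + 1) → S) :
    |lagProdComb g W a y| ≤ (∑ t : Fin (W + 1), |a t|) * C ^ 2 := by
  unfold lagProdComb
  refine (abs_sum_le_sum_abs _ _).trans ?_
  rw [sum_mul]
  refine sum_le_sum fun t _ => ?_
  rw [abs_mul, abs_mul, sq]
  exact mul_le_mul_of_nonneg_left
    (mul_le_mul (hC _) (hC _) (abs_nonneg _) ((abs_nonneg _).trans (hC (y 0)))) (abs_nonneg _)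

end LagProdComb

variable [MeasurableSpace S]

/-- Measurability of `lagProdComb g W a` for measurable `g`. -/
theorem measurable_lagProdComb {g : S → ℝ} (hg : Measurable g) (W : ℕ) (a : EuclideanSpace ℝ (Fin (W + 1))) :
    Measurable (lagProdComb g W a) := by
  unfold lagProdComb
  exact Finset.measurable_sum _ fun t _ =>
    measurable_const.mul ((hg.comp (measurable_pi_apply 0)).mul (hg.comp (measurable_pi_apply t)))

/-! ## The projection algebra -/

section Algebra

/-- `(√N)⁻¹ Σ_{i<N} (Σ_t a_t u_t(i) − Σ_t a_t c_t) = ⟪a, √N • ((Σ_{i<N} u_t(i) / N)_t − (c_t)_t)⟫`. -/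
theorem inner_sqrt_smul_sub_eq {W : ℕ} (a : EuclideanSpace ℝ (Fin (W + 1))) (u : Fin (W + 1) → ℕ → ℝ)
    (c : Fin (W + 1) → ℝ) (N : ℕ) :
    (Real.sqrt N)⁻¹ * ∑ i ∈ range N, (∑ t : Fin (W + 1), a t * u t i - ∑ t : Fin (W + 1), a t * c t)
      = ⟪a, Real.sqrt N • (toLp 2 (fun t : Fin (W + 1) => (∑ i ∈ range N, u t i) / N) - toLp 2 c)⟫ := by
  rw [PiLp.inner_apply]
  simp only [PiLp.smul_apply, PiLp.sub_apply, RCLike.inner_apply, conj_trivial, smul_eq_mul]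
  simp_rw [← sum_sub_distrib]
  rw [sum_comm, mul_sum]
  refine sum_congr rfl fun t _ => ?_
  rw [sum_sub_distrib, ← mul_sum, sum_const, card_range, nsmul_eq_mul]
  rcases Nat.eq_zero_or_pos N with hN | hN
  · subst hN
    simp
  · have hNR : (0 : ℝ) < N := Nat.cast_pos.2 hN
    set s := Real.sqrt (N : ℝ) with hs
    have hs0 : s ≠ 0 := by rw [hs]; exact Real.sqrt_ne_zero'.2 hNR
    have hN2 : (N : ℝ) = s * s := by rw [hs, Real.mul_self_sqrt hNR.le]
    rw [hN2]
    field_simp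

end Algebra

/-! ## The joint CLT for the chain's empirical autocovariances -/

section ChainAcov

variable (κ : Kernel S S) [IsMarkovKernel κ] {π : Measure S} [IsProbabilityMeasure π]
  {ν : Measure S} [IsProbabilityMeasure ν] {ε : ℝ≥0∞} {m : ℕ}

/-- **The stationary mean of the lag-product combination**:
`E_π[Σ_t a_t g(X_0) g(X_t)] = Σ_t a_t · autocov κ π g t` for bounded measurable `g`. -/
theorem integral_lagProdComb_window_zero (hπ : Kernel.Invariant κ π)
    {g : S → ℝ} (hg : Measurable g) {C : ℝ} (hC : ∀ z, |g z| ≤ C) (W : ℕ)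
    (a : EuclideanSpace ℝ (Fin (W + 1))) :
    ∫ x, lagProdComb g W a (windowPath W x 0) ∂(Kernel.trajMeasure (X := fun _ : ℕ => S) π
        (fun n : ℕ => κ.comap (fun hh : (i : ↥(Finset.Iic n)) → S => hh ⟨n, Finset.mem_Iic.2 le_rfl⟩)
          (measurable_pi_apply _)))
      = ∑ t : Fin (W + 1), a t * autocov κ π g t := by
  have hXm : ∀ i : ℕ, Measurable fun x : ℕ → S => g (x i) := fun i => hg.comp (measurable_pi_apply i)
  simp only [lagProdComb_windowPath]
  rw [integral_finsetSum _ (fun t _ => ?_)]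
  · refine sum_congr rfl fun t _ => ?_
    rw [integral_const_mul, chain_autocov hπ hg hC 0 t]
  · have hprod : Measurable fun x : ℕ → S => g (x 0) * g (x (0 + (t : ℕ))) := (hXm 0).mul (hXm _)
    exact (integrable_of_bounded _ hprod (C := C * C)
      (fun x => by
        rw [abs_mul]
        exact mul_le_mul (hC _) (hC _) (abs_nonneg _) ((abs_nonneg _).trans (hC (x 0))))).const_mul _

/-- **THE JOINT CLT FOR THE EMPIRICAL AUTOCOVARIANCES OF A CHAIN WITH A DOEBLIN POWER, FROM ANY INITIAL
LAW.**  `κ` Markov with invariant probability `π`, `(nHit κ m)(z, ·) ≥ ε ν` for all `z` (`ε ≠ 0`,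
`0 < m`); `|f| ≤ C` measurable, `f̄ = f − ∫ f dπ`; `Γ̂_N(t) = (1/N) Σ_{i<N} f̄(X_i) f̄(X_{i+t})`
(`Scoring.acovHat` of `f̄` read along the path, known mean) and `C(t) = Scoring.autocov κ π f̄ t`.
Let `Z` be a random vector of `ℝ^{W+1}` with `⟪a, Z⟫ ∼ N(0, windowLRVar κ π W (lagProdComb f̄ W a))` for
every `a`.  Then for EVERY initial law `μ₀`:
`√N • ((Γ̂_N(t))_{t≤W} − (C(t))_{t≤W}) ⇒ Z` under `P_{μ₀}`. -/
theorem tendstoInDistribution_chain_acovHat_of_nHit (hπ : Kernel.Invariant κ π) (hε : ε ≠ 0)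
    (hmin : ∀ z, ε • ν ≤ nHit κ m z) (hm : 0 < m)
    {f : S → ℝ} (hf : Measurable f) {C : ℝ} (hC : ∀ z, |f z| ≤ C) (W : ℕ)
    (μ₀ : Measure S) [IsProbabilityMeasure μ₀]
    {Ω' : Type*} [MeasurableSpace Ω'] {P' : Measure Ω'} [IsProbabilityMeasure P']
    {Z : Ω' → EuclideanSpace ℝ (Fin (W + 1))} (hZm : AEMeasurable Z P')
    (hZ : ∀ a : EuclideanSpace ℝ (Fin (W + 1)), HasLaw (fun ω' => ⟪a, Z ω'⟫)
      (gaussianReal 0 (windowLRVar κ π W (lagProdComb (fun z => f z - ∫ z', f z' ∂π) W a)).toNNReal) P')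
    [IsProbabilityMeasure (Kernel.trajMeasure (X := fun _ : ℕ => S) μ₀
        (fun n : ℕ => κ.comap (fun hh : (i : ↥(Finset.Iic n)) → S => hh ⟨n, Finset.mem_Iic.2 le_rfl⟩)
          (measurable_pi_apply _)))] :
    TendstoInDistribution
      (fun (N : ℕ) (x : ℕ → S) => Real.sqrt N
        • (toLp 2 (fun t : Fin (W + 1) =>
            acovHat (fun (i : ℕ) (x : ℕ → S) => f (x i) - ∫ z', f z' ∂π) N t x)
          - toLp 2 (fun t : Fin (W + 1) => autocov κ π (fun z => f z - ∫ z', f z' ∂π) t)))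
      atTop Z (fun _ => Kernel.trajMeasure (X := fun _ : ℕ => S) μ₀
        (fun n : ℕ => κ.comap (fun hh : (i : ↥(Finset.Iic n)) → S => hh ⟨n, Finset.mem_Iic.2 le_rfl⟩)
          (measurable_pi_apply _))) P' := by
  set P := Kernel.trajMeasure (X := fun _ : ℕ => S) μ₀
    (fun n : ℕ => κ.comap (fun hh : (i : ↥(Finset.Iic n)) → S => hh ⟨n, Finset.mem_Iic.2 le_rfl⟩)
      (measurable_pi_apply _)) with hP
  set Pπ := Kernel.trajMeasure (X := fun _ : ℕ => S) π
    (fun n : ℕ => κ.comap (fun hh : (i : ↥(Finset.Iic n)) → S => hh ⟨n, Finset.mem_Iic.2 le_rfl⟩)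
      (measurable_pi_apply _)) with hPπ
  -- the centred observable
  set fb : S → ℝ := fun z => f z - ∫ z', f z' ∂π with hfb
  have hfbm : Measurable fb := hf.sub measurable_const
  have hmean : |∫ z', f z' ∂π| ≤ C := by
    rw [← Real.norm_eq_abs]
    calc ‖∫ z', f z' ∂π‖ ≤ C * π.real Set.univ :=
          norm_integral_le_of_norm_le_const (Eventually.of_forall fun z => by
            rw [Real.norm_eq_abs]; exact hC z)
      _ = C := by rw [probReal_univ, mul_one]
  have hfbC : ∀ z, |fb z| ≤ 2 * C := fun z => by
    calc |fb z| = |f z - ∫ z', f z' ∂π| := rfl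
      _ ≤ |f z| + |∫ z', f z' ∂π| := abs_sub _ _
      _ ≤ C + C := add_le_add (hC z) hmean
      _ = 2 * C := by ring
  -- measurability of the vector statistic
  have hXm : ∀ i : ℕ, Measurable fun x : ℕ → S => fb (x i) := fun i => hfbm.comp (measurable_pi_apply i)
  have hAm : ∀ N t : ℕ, Measurable (acovHat (fun (i : ℕ) (x : ℕ → S) => fb (x i)) N t) := fun N t => by
    unfold acovHat
    exact (Finset.measurable_sum _ fun i _ => (hXm i).mul (hXm (i + t))).div_const _
  have hTm : ∀ N : ℕ, Measurable fun x : ℕ → S =>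
      toLp 2 (fun t : Fin (W + 1) => acovHat (fun (i : ℕ) (x : ℕ → S) => fb (x i)) N t x) := fun N =>
    (WithLp.measurable_toLp 2 _).comp (measurable_pi_lambda _ fun t => hAm N t)
  have hSm : ∀ N : ℕ, AEMeasurable (fun x : ℕ → S => Real.sqrt N
      • (toLp 2 (fun t : Fin (W + 1) => acovHat (fun (i : ℕ) (x : ℕ → S) => fb (x i)) N t x)
        - toLp 2 (fun t : Fin (W + 1) => autocov κ π fb t))) P := fun N =>
    (((hTm N).sub_const _).const_smul (Real.sqrt N)).aemeasurable
  refine CardConsistency.tendstoInDistribution_of_forall_inner (P := fun _ => P) hSm hZm fun a => ?_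
  -- the window functional `φ_a(y) = Σ_t a_t f̄(y_0) f̄(y_t)`
  have hφm : Measurable (lagProdComb fb W a) := measurable_lagProdComb hfbm W a
  have hφC : ∀ y, |lagProdComb fb W a y| ≤ (∑ t : Fin (W + 1), |a t|) * (2 * C) ^ 2 :=
    abs_lagProdComb_le hfbC W a
  have hclt := tendstoInDistribution_windowAverage_of_nHit κ W hπ hε hmin hm hφm hφC μ₀
    (Z := fun ω' => ⟪a, Z ω'⟫) (hZ a)
  rw [← hPπ] at hclt
  -- its stationary mean is `Σ_t a_t C(t)`
  have hcen : ∫ x', lagProdComb fb W a (windowPath W x' 0) ∂Pπ = ∑ t : Fin (W + 1), a t * autocov κ π fb t := by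
    rw [hPπ]; exact integral_lagProdComb_window_zero κ hπ hfbm hfbC W a
  rw [hcen] at hclt
  refine hclt.congr (fun N => Eventually.of_forall fun x => ?_) EventuallyEq.rfl
  simp only [lagProdComb_windowPath]
  exact inner_sqrt_smul_sub_eq a (fun t i => fb (x i) * fb (x (i + t))) (fun t => autocov κ π fb t) N

end ChainAcov

end Summit.Ventures.LatticeQCDFlow.Scoring

end
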